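import Summits.ValiantsHypothesis.ValiantsHypothesis.Theorems.DivisionGapPerDivisionHardStubExposedRigid
import Summits.ValiantsHypothesis.ValiantsHypothesis.Theorems.DivisionGapPerDivisionHardStubExposedOfIsolated
import Summits.ValiantsHypothesis.ValiantsHypothesis.Theorems.DivisionGapPerDivisionHardIsolation
import Summits.ValiantsHypothesis.ValiantsHypothesis.Theorems.DivisionGapPerDivisionHardStubPricedCut

/-!
# Crux `DivisionGap.PerDivisionHard` (stmt-ValiantsHypothesis-5065), line `pair-descent-jss-endpoint` —
the EXPOSED-POINT rung (skeleton v15.3, chapter RIGID CELLS, part F): priced isolation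

`PerDivisionHard` asks: for every `c`, for all large `n`, every nonzero `h ∈ ℝ≥0[x_ij]` has
`2^{(log₂ n + c)^c} < L(per_n · h) + L(h)`.  The priced cut of the line (`stub_pricedCut`, seat c8) makes
the top fibre the set of minimisers of ANY positive price functional off the placed face.  Hence
(`perDivisionHard_exposed`): if all monomials of `h ≠ 0` have one degree and, for some cell set `K` with
`4|K| ≤ n` and some prices `p ≥ 0`, the functional `m ↦ Σ_{e∈K} p(e)·m(e)` has a UNIQUE minimiser on
`supp h` — `ms|_K` is a point of the projection `proj_K(supp h)` EXPOSED from below —, then the crux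
inequality holds: face off `K` (`stub_keyPlacement`), prices `1 + (D+1)·p·𝟙_K` (`stub_exposedRigid`).
For general `h` apply it to the top-degree part (`perDivisionHard_exposedTop`).

This is the small-support, h-alone form of STEERED K2's "vertex of the dominant" (dossier v8 §4), and the
top of the placement-only hierarchy of this chapter:
EXPOSED ⊇ ISOLATED (lexicographic prices `B^{t-1-i}`, `stub_exposedOfIsolated`; the re-derivation of
`perDivisionHard_isolation` from `perDivisionHard_exposed` is kernel-checked in the line's workfile
`Cruxes/PerDivisionHard/Lines/pair_descent_jss_endpoint.lean`, `perDivisionHard_isolation_of_exposed`) ⊇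
KEYED (`…Keys.lean`) ⊇ JSS's monomial cofactors; and EXPOSED with one cell is
the unique-argmin rung that decides the free-default adversary `h_bal`.
Residual: for every `K` with `4|K| ≤ n` and every `p ≥ 0` on `K`, the bottom face of `proj_K(supp h₁)` in
direction `p` carries at least two monomials of the top-degree part `h₁` of an undecided cofactor.

Capstone (`perDivisionHard_steerable`, the honest frontier of the whole line in one statement): if for
SOME placement of the block arsenal and SOME prices `p ≥ 0` on the cells off its face the price
functional has a unique minimiser on the (one-degree) support, the crux inequality holds; every rung of
the chapter is an explicit instance, and the open h-alone statement of the line (STEERED K2 without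
lures) is exactly "every cheap one-degree support is steerable".
-/

noncomputable section

-- `Summit.ValiantsHypothesis.ValiantsHypothesis.…` is the tree's mandated single-conjunct layout
-- (Sub = Summit), so the duplicated namespace component is intended.
set_option linter.dupNamespace false

namespace Summit.ValiantsHypothesis.ValiantsHypothesis.Theorems.DivisionGapPerDivisionHard

open MvPolynomial Literature.Computability.AlgebraicComplexity
open Summit.ValiantsHypothesis.ValiantsHypothesis.Theorems.ZeroOneTransfer.Negative
  (topComponent topComponent_ne_zero)
open scoped NNReal

/-- **The EXPOSED-POINT rung of `PerDivisionHard`, one-degree form.**  For every `c` there is `n₀`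
such that for all `n ≥ n₀` and every nonzero `h` all of whose monomials have the same degree: if some
nonnegative price functional supported on a cell set `K` with `4|K| ≤ n` has a unique minimiser `ms` on
`supp h`, then `2^{(log₂ n+c)^c} < L(per_n·h) + L(h)`. -/
theorem perDivisionHard_exposed :
    ∀ c : ℕ, ∃ n₀ : ℕ, ∀ n ≥ n₀, ∀ h : MvPolynomial (Fin n × Fin n) ℝ≥0, h ≠ 0 →
      (∀ m₁ ∈ h.support, ∀ m₂ ∈ h.support, m₁.degree = m₂.degree) →
      ∀ (K : Finset (Fin n × Fin n)) (p : Fin n × Fin n → ℕ), 4 * K.card ≤ n →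
      ∀ ms ∈ h.support,
      (∀ m' ∈ h.support, m' ≠ ms → ∑ e ∈ K, p e * ms e < ∑ e ∈ K, p e * m' e) →
      2 ^ ((Nat.log 2 n + c) ^ c) < complexity (perPoly (Fin n) ℝ≥0 * h) + complexity h := by
  intro c
  obtain ⟨κ, hcon⟩ := stub_jssContraction
  obtain ⟨d, n₁, hhard⟩ := stub_blockArsenal c κ
  obtain ⟨n₀, hS⟩ := stub_exposedRigid d
  refine ⟨n₀ + n₁, fun n hn h hh hdeg K p hK ms hms hexp => ?_⟩
  obtain ⟨b, k, m, eR, eC, w, u, hb, hcut, hsingle⟩ := hS n (by omega) h hh hdeg K p hK ms hms hexp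
  exact two_pow_lt_of_rigid c κ d n₁ n hcon hhard (by omega) hh le_rfl eR eC w u hb hcut hsingle

/-- **The EXPOSED-POINT rung, general form via the top-degree part.**  For every `c` there is `n₀`
such that for all `n ≥ n₀` and every nonzero `h`: if some nonnegative price functional supported on `K`,
`4|K| ≤ n`, has a unique minimiser on the support of the TOP-DEGREE part of `h`, then
`2^{(log₂ n+c)^c} < L(per_n·h) + L(h)` (`stub_topTransfer` with the constant character). -/
theorem perDivisionHard_exposedTop :
    ∀ c : ℕ, ∃ n₀ : ℕ, ∀ n ≥ n₀, ∀ h : MvPolynomial (Fin n × Fin n) ℝ≥0, h ≠ 0 →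
      ∀ (K : Finset (Fin n × Fin n)) (p : Fin n × Fin n → ℕ), 4 * K.card ≤ n →
      ∀ ms ∈ (topComponent (fun e : Fin n × Fin n => (fun _ : Fin n => 1) e.1 + (fun _ : Fin n => 0) e.2) h).support,
      (∀ m' ∈ (topComponent (fun e : Fin n × Fin n => (fun _ : Fin n => 1) e.1 + (fun _ : Fin n => 0) e.2) h).support,
        m' ≠ ms → ∑ e ∈ K, p e * ms e < ∑ e ∈ K, p e * m' e) →
      2 ^ ((Nat.log 2 n + c) ^ c) < complexity (perPoly (Fin n) ℝ≥0 * h) + complexity h := by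
  intro c
  obtain ⟨n₀, hE⟩ := perDivisionHard_exposed c
  refine ⟨n₀, fun n hn h hh K p hK ms hms hexp => ?_⟩
  obtain ⟨hle1, hle2⟩ := stub_topTransfer n (fun _ => 1) (fun _ => 0) h
  exact lt_of_lt_of_le (hE n hn _ (topComponent_ne_zero _ hh)
    (fun m₁ hm₁ m₂ hm₂ => degree_eq_of_mem_support_topComponent_one h hm₁ hm₂) K p hK ms hms hexp)
    (Nat.add_le_add hle1 hle2)

/-- **The STEERABLE rung (capstone of the chapter; the honest frontier).**  For every `c` there are
`d, n₀` such that for all `n ≥ n₀` and every nonzero `h` all of whose monomials have the same degree: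
if for SOME placement `eR eC` of the block arsenal (`b ≥ (log₂ n + d)^d`) and SOME prices `p ≥ 0` on the
cells off its face the functional `m ↦ Σ_{e ∉ G} p(e)·m(e)` has a unique minimiser on `supp h`, then
`2^{(log₂ n+c)^c} < L(per_n·h) + L(h)` (`stub_pricedCut` with prices `1 + (D+1)·p`, then the common
tail).  Every rung of this chapter is an instance with an explicit `(placement, p)`; the open h-alone
statement of the line (STEERED K2 without lures) is precisely "every cheap one-degree support is
steerable in this sense". -/
theorem perDivisionHard_steerable :
    ∀ c : ℕ, ∃ d n₀ : ℕ, ∀ n ≥ n₀, ∀ h : MvPolynomial (Fin n × Fin n) ℝ≥0, h ≠ 0 →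
      (∀ m₁ ∈ h.support, ∀ m₂ ∈ h.support, m₁.degree = m₂.degree) →
      ∀ (b k m : ℕ) (eR eC : BlockV b k m ≃ Fin n) (p : Fin n × Fin n → ℕ),
      (Nat.log 2 n + d) ^ d ≤ b →
      ∀ ms ∈ h.support,
      (∀ m' ∈ h.support, m' ≠ ms →
        ∑ e ∈ Finset.univ.filter (fun e => e ∉ placedBlock eR eC), p e * ms e <
          ∑ e ∈ Finset.univ.filter (fun e => e ∉ placedBlock eR eC), p e * m' e) →
      2 ^ ((Nat.log 2 n + c) ^ c) < complexity (perPoly (Fin n) ℝ≥0 * h) + complexity h := by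
  intro c
  obtain ⟨κ, hcon⟩ := stub_jssContraction
  obtain ⟨d, n₁, hhard⟩ := stub_blockArsenal c κ
  refine ⟨d, n₁, fun n hn h hh hdeg b k m eR eC p hb ms hms hexp => ?_⟩
  classical
  set G := placedBlock eR eC with hG
  set D := h.totalDegree with hD
  set pr : Fin n × Fin n → ℕ := fun e => 1 + (D + 1) * p e with hpr
  obtain ⟨w, hcut, hchar⟩ := stub_pricedCut b k m n eR eC ∅ ∅ pr h
    (Finset.disjoint_empty_left _) (fun e _ _ => by simp [hpr]) hdeg
  set F : Finset (Fin n × Fin n) := (Finset.univ : Finset (Fin n × Fin n)).filter (fun e => e ∉ G ∧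
      ¬ ∃ p' ∈ (∅ : Finset (Fin m)), ∃ q ∈ (∅ : Finset (Fin m)),
        e = (eR (Sum.inr (Sum.inr p')), eC (Sum.inr (Sum.inr q)))) with hF
  have hFF : F = Finset.univ.filter (fun e => e ∉ G) := by
    ext e
    simp [hF]
  have hΦ : ∀ mo : (Fin n × Fin n) →₀ ℕ,
      ∑ e ∈ F, pr e * mo e = ∑ e ∈ F, mo e + (D + 1) * ∑ e ∈ F, p e * mo e := by
    intro mo
    have hsplit : ∀ e, pr e * mo e = mo e + (D + 1) * (p e * mo e) := by
      intro e; simp only [hpr]; ring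
    rw [Finset.sum_congr rfl fun e _ => hsplit e, Finset.sum_add_distrib, ← Finset.mul_sum]
  have hfib : ∀ mo ∈ (topComponent w h).support, mo = ms := by
    intro mo hmo
    obtain ⟨hmoh, hmin⟩ := (hchar mo).mp hmo
    by_contra hne
    have hlt := hexp mo hmoh hne
    rw [← hFF] at hlt
    have hle := hmin ms hms
    rw [hΦ mo, hΦ ms] at hle
    have hD' : ∑ e ∈ F, ms e ≤ D := sum_le_totalDegree_of_mem_support hms F
    have hstep : (D + 1) * (∑ e ∈ F, p e * ms e + 1) ≤ (D + 1) * ∑ e ∈ F, p e * mo e :=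
      Nat.mul_le_mul_left _ hlt
    nlinarith [Finset.sum_nonneg (fun e (_ : e ∈ F) => Nat.zero_le (mo e))]
  have hsingle : HasSingleGPart G w h (ms.filter (· ∈ G)) := by
    refine ⟨fun f hf => ?_, fun m' hm' f hf => ?_⟩
    · rw [Finsupp.support_filter] at hf
      exact (Finset.mem_filter.mp hf).2
    · rw [hfib m' hm', Finsupp.filter_apply_pos _ _ hf]
  exact two_pow_lt_of_rigid c κ d n₁ n hcon hhard hn hh le_rfl eR eC w _ hb hcut hsingle

/-- **The STEERABLE-WITH-LURES rung (the capstone in the full steering vocabulary of the line: magnets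
AND lures).**  For every `c` there are `d, n₀` such that for all `n ≥ n₀` and every nonzero `h` all of
whose monomials have the same degree: if for SOME placement `eR eC` of the block arsenal
(`b ≥ (log₂ n + d)^d`), SOME lure rectangle `P × Q` of padding indices (`P`, `Q` disjoint; empty allowed)
and SOME prices `p ≥ 0` on the cells that are neither face cells nor lure cells, the functional
`m ↦ Σ_{e off} p(e)·m(e)` has a unique minimiser on `supp h`, then `2^{(log₂ n+c)^c} < L(per_n·h) + L(h)`
(`stub_pricedCut` with prices `1 + (D+1)·p`; the lure cells get the face weight and the weight still cuts
out the face, `stub_lureCutsOut`).  `perDivisionHard_steerable` is the case `P = Q = ∅`. -/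
theorem perDivisionHard_steerableLure :
    ∀ c : ℕ, ∃ d n₀ : ℕ, ∀ n ≥ n₀, ∀ h : MvPolynomial (Fin n × Fin n) ℝ≥0, h ≠ 0 →
      (∀ m₁ ∈ h.support, ∀ m₂ ∈ h.support, m₁.degree = m₂.degree) →
      ∀ (b k m : ℕ) (eR eC : BlockV b k m ≃ Fin n) (P Q : Finset (Fin m)) (p : Fin n × Fin n → ℕ),
      Disjoint P Q → (Nat.log 2 n + d) ^ d ≤ b →
      ∀ ms ∈ h.support,
      (∀ m' ∈ h.support, m' ≠ ms →
        ∑ e ∈ Finset.univ.filter (fun e => e ∉ placedBlock eR eC ∧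
            ¬ ∃ p' ∈ P, ∃ q ∈ Q, e = (eR (Sum.inr (Sum.inr p')), eC (Sum.inr (Sum.inr q)))), p e * ms e <
          ∑ e ∈ Finset.univ.filter (fun e => e ∉ placedBlock eR eC ∧
            ¬ ∃ p' ∈ P, ∃ q ∈ Q, e = (eR (Sum.inr (Sum.inr p')), eC (Sum.inr (Sum.inr q)))), p e * m' e) →
      2 ^ ((Nat.log 2 n + c) ^ c) < complexity (perPoly (Fin n) ℝ≥0 * h) + complexity h := by
  intro c
  obtain ⟨κ, hcon⟩ := stub_jssContraction
  obtain ⟨d, n₁, hhard⟩ := stub_blockArsenal c κ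
  refine ⟨d, n₁, fun n hn h hh hdeg b k m eR eC P Q p hPQ hb ms hms hexp => ?_⟩
  classical
  set G := placedBlock eR eC with hG
  set D := h.totalDegree with hD
  set pr : Fin n × Fin n → ℕ := fun e => 1 + (D + 1) * p e with hpr
  obtain ⟨w, hcut, hchar⟩ := stub_pricedCut b k m n eR eC P Q pr h hPQ (fun e _ _ => by simp [hpr]) hdeg
  set F : Finset (Fin n × Fin n) := (Finset.univ : Finset (Fin n × Fin n)).filter (fun e => e ∉ G ∧
      ¬ ∃ p' ∈ P, ∃ q ∈ Q, e = (eR (Sum.inr (Sum.inr p')), eC (Sum.inr (Sum.inr q)))) with hF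
  have hΦ : ∀ mo : (Fin n × Fin n) →₀ ℕ,
      ∑ e ∈ F, pr e * mo e = ∑ e ∈ F, mo e + (D + 1) * ∑ e ∈ F, p e * mo e := by
    intro mo
    have hsplit : ∀ e, pr e * mo e = mo e + (D + 1) * (p e * mo e) := by
      intro e; simp only [hpr]; ring
    rw [Finset.sum_congr rfl fun e _ => hsplit e, Finset.sum_add_distrib, ← Finset.mul_sum]
  have hfib : ∀ mo ∈ (topComponent w h).support, mo = ms := by
    intro mo hmo
    obtain ⟨hmoh, hmin⟩ := (hchar mo).mp hmo
    by_contra hne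
    have hlt := hexp mo hmoh hne
    have hle := hmin ms hms
    rw [hΦ mo, hΦ ms] at hle
    have hD' : ∑ e ∈ F, ms e ≤ D := sum_le_totalDegree_of_mem_support hms F
    have hstep : (D + 1) * (∑ e ∈ F, p e * ms e + 1) ≤ (D + 1) * ∑ e ∈ F, p e * mo e :=
      Nat.mul_le_mul_left _ hlt
    nlinarith [Finset.sum_nonneg (fun e (_ : e ∈ F) => Nat.zero_le (mo e))]
  have hsingle : HasSingleGPart G w h (ms.filter (· ∈ G)) := by
    refine ⟨fun f hf => ?_, fun m' hm' f hf => ?_⟩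
    · rw [Finsupp.support_filter] at hf
      exact (Finset.mem_filter.mp hf).2
    · rw [hfib m' hm', Finsupp.filter_apply_pos _ _ hf]
  exact two_pow_lt_of_rigid c κ d n₁ n hcon hhard hn hh le_rfl eR eC w _ hb hcut hsingle

end Summit.ValiantsHypothesis.ValiantsHypothesis.Theorems.DivisionGapPerDivisionHard

end
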